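import Summits.CriticalPhenomena.PercolationContinuityZ3.Theorems.PercNearOneGluingNoHeavyLowerTailSahiOneStepFibreF3CheckDefs
import HarnessLib

/-!
# One-step scheme: the fibre-form checks for AT MOST FOUR free coordinates (computational, `native_decide`)

Computational support file (prover prim-ineq-prove-3 gen 16; `--supports stmt-CriticalPhenomena-4575`, `--computational`; memo
`run/shared/lean/prim/prim-ineq-prove-3/FINDING-G16-FIBRE-MAJ5.md` §3.6, §3.8).  `checkSlow d1 d2 θ = true` (`…FibreF3CheckDefs`) for all
`d1 + d2 ≤ 4`, `1 ≤ θ ≤ d1 + d2`, by `native_decide` (a few seconds; 168² pairs of upper families of `P(range 4)` at most).  Soundness of the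
checker is `…FibreF3CheckSound.checkSlow_sound`.
-/

namespace Summit.CriticalPhenomena.PercolationContinuityZ3.Theorems

namespace SahiOneStep

/-- **All three-copy fibre forms on at most four free coordinates pass the checker.** [this work, by computation] -/
theorem checkSlow_le_four : ∀ d1 ∈ Finset.range 5, ∀ d2 ∈ Finset.range 5, ∀ θ ∈ Finset.range 5,
    d1 + d2 ≤ 4 → 1 ≤ θ → θ ≤ d1 + d2 → checkSlow d1 d2 θ = true := by
  native_decide

/-- Pointwise form of `checkSlow_le_four`. -/
theorem checkSlow_eq_true {d1 d2 θ : ℕ} (hd : d1 + d2 ≤ 4) (h1 : 1 ≤ θ) (h2 : θ ≤ d1 + d2) : checkSlow d1 d2 θ = true :=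
  checkSlow_le_four d1 (Finset.mem_range.2 (by omega)) d2 (Finset.mem_range.2 (by omega)) θ (Finset.mem_range.2 (by omega)) hd h1 h2

end SahiOneStep

end Summit.CriticalPhenomena.PercolationContinuityZ3.Theorems
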